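import Literature.MathematicalPhysics.QuantumFieldTheory.Balaban1983to89.Node00.DatumAvLayer
import Literature.MathematicalPhysics.QuantumFieldTheory.Balaban1983to89.B12Eq019ActionBody
import Literature.MathematicalPhysics.QuantumFieldTheory.Balaban1983to89.B12GaugeOrbits021
import Literature.MathematicalPhysics.QuantumFieldTheory.Balaban1983to89.FlowStepRuns
import Literature.MathematicalPhysics.QuantumFieldTheory.Balaban1983to89.T4FlagMemory

/-!
# Node00 / BackgroundActionOfRecord — the background configurations `U_k(V)`, the Wilson action `A^η(U_k(V))`, the
effective actions `A_k`, the expansion terms `𝐄_k` and the merged per-step terms `𝓝_{k+1}` OF RECORD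

[Balaban1987RG1] = [I] (CMP 109, 1987) (0.17)–(0.24) pp. 255–256, (1.1)–(1.2) p. 260, (1.3)–(1.7) pp. 260–261;
[Balaban1985Variational] = [B11] (CMP 102, 1985) Thm 1 p. 279 (existence and uniqueness modulo gauge of the minimal orbit).

STAGE ₈a of the record of `Node00/Record5.lean` (seat pub-ymgap-node00-def-B; contract = the FROZEN field names ∕ types of
`Residual₅`: `effAction`, `wilsonBG`, `Ek : (p : B12.RunParams) → (k : ℕ) → GaugeField (F.P p.K) k (SU N) → ℝ` and the format
predicates `ReprA`, `IndA`).  This module delivers FUNCTIONS producing those fields' values from the family `F`, the rank `N`, the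
characteristic functions `χ : (K : ℕ) → (ℕ → ℝ) → (k : ℕ) → Density (F.P K) k (SU N)`
(stage ₇ — per torus, coupling sequence and step; a typed parameter here), the β-functions `β` (stage ₈b, `Node00.BetaOfRecord`, a typed
parameter here) and ONE new numeric parameter `ε` (print's `ε₀` of [I] (1.2)); the assembler plugs them into `Residual₈`.

LEAN IDIOM OF RECORD (chair ruling R434 (c1)–(c3)): TOTAL DEFINITIONS NOW, PROPERTIES LATER, NOTHING OF PRINT ASSERTED.
* §1 `U_k(V)` ([I] (0.21), (1.1)): `Uk … V := if h : ∃ U₀, IsBackground … V U₀ then Classical.choose h else 1` over the tree's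
  one-scale minimiser predicate `Setup.IsBackground` along the averaging of record `avOfRecord` within the plaquette class
  `bgReg K k ε = {U | |U(∂p) − 1| < ε η_k²}` ((1.2), `η_k = L^{−k}`); the existence `UkExists` is a NAMED Prop ([B11] Thm 1 is its
  content — a hypothesis of `isBackground_Uk`, never asserted); the uniqueness clause of (1.1) is the named Prop `UniqueUkOrbit`.
  `wilsonBGOfRecord ε p k V := A^η(U_k(V))` (`wilsonAction4`, `d = 4`); its VALUE does not depend on the representative of the
  minimal set (`wilsonAction4_eq_of_isBackground`), so the gauge ambiguity of `U_k(V)` never reaches a consumer.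
* §2 `A_k` ((0.17)∕(0.19) WITH BODY): `effActionH χ K g := B12Eq019ActionBody.printedSeq (TrhoOfRecord F N K ·) (χ K g) (gfOfRecord K) g 1`
  — the printed recursion `A_0 = −(1/g_0²)A`, `A_{k+1} = 𝐓_k A_k` at the renormalisation transformation OF RECORD, over a FREE coupling
  sequence `g` (the run reads the forward-generated one, `FlowStepRuns.genSeq β g₀`); the gauge-fixing term of (0.19) is PINNED as the
  double sum `Σ_y Σ_{x ∈ B(y), x ≠ y} [1 − Re tr U(y,x)]` (`Setup.gaugeFixFn`) at the averaged contour variables `U(y,x)` of (0.11)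
  ([I] p. 254: «We use the variables U(y,x) defined in (0.11)») with Federbush's inner mean (0.10) (`BlockAveragingTwoLevel.contourData
  FederbushMean.federbushSU`).  `EkOfRecord := A_k + (1/g_k²)·A^η(U_k)` — (0.22) READ AS THE DEFINITION of `𝐄_k(U_k(V))` (as
  `B12Eq019ActionBody.Ek_eq_of_repr` reads it); the identity (0.22) at the record is then `effActionOfRecord_eq_repr022` (by `ring`) — SAID.
  The normalisation constants `𝐍_k` of (0.19) at the record (`normConstH` ∕ `normConstOfRecord` = `B12Eq019ActionBody.normConst` at the
  transformation, characteristic functions and gauge fixing of record) are exported as the ₈-side input of stage ₇'s vacuum energy `E`.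
* §3 the MERGED per-step terms of (1.6) p. 261 (design (β) of dag-n09-b's STAGE8-BETA-SCOPING §7): `mergedTerm χ ε K g k W :=
  A_{k+1}(W) − A_k(Ū^k(U_{k+1}(W)))` = print's `𝐄^{(k+1)}(g_k, U_{k+1}(W)) − 𝐄^{(k+1)}(g_k, 1)` under the representation (1.6) (a theorem of
  [I], not asserted), exported in the shape `Node00.TermFamily1 F 𝔄` of `Node00.BetaOfRecord` as `mergedTermFamily … r` for any carrier `𝔄` read into
  `SU(N)` by `r` (matrices: the total retraction `suOfMat`, `mergedTermFamilyMat`), so that the β-functions of record are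
  `betaOfMerged (betaMerged F (mergedTermFamily F N χ ε r) ρ bV) (beta0OfMerged …) γ` — ONE assembly line.
* §4 the format predicates: `ReprAOfRecord` = (0.22) ∧ (0.23)-at-the-merged-terms; `IndAOfRecord` = (1.1) (existence `UkExists` and
  uniqueness `UniqueUkOrbit` on the domain) ∧ `ReprAOfRecord` ((1.3)∕(1.6) form).  At the record's own objects the conjunct (0.22) holds
  by `ring` (its content moved into `effAction := printedSeq …`); (0.23) is the composition-of-minimisers bookkeeping — a THEOREM needing
  [B11] uniqueness modulo gauge and the gauge invariance of `A_j` (nodes N07 ∕ N09), not definitional.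
LOCATED DIVERGENCES. D-defB-1: the current clause `|J| < ε₀`, `J = D*_U η^{−2} π Im ∂U` of (1.2) is NOT part of the typed minimisation
class (on the minimal orbit it is the conclusion (9)–(10) of [B11] Thm 1; the tree blesses exactly the plaquette class for `IsBackground`:
`B12GaugeOrbits021.plaqSmall_stable`).  D-defB-2: the localized terms `𝐄^{(j)}(X, ·)` of (0.24)∕(1.7), their analytic extensions (1.9) and
`log Z^{(j)}` as separate objects are NOT objects of this module (no typed carrier before [II]); every estimate — (0.25)–(0.30), (1.8)–(1.19),
the β-clause p. 264 — is DISPLAYED, never pinned.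
HONEST FRAMING: definitions of record and unfolding ∕ bookkeeping lemmas; nothing of Bałaban's asserted; no estimate; no satisfiability;
counts unmoved; one finite `T⁴` per run; NOT continuum ∕ ℝ⁴ ∕ OS ∕ mass-gap ∕ Clay.
-/

noncomputable section

open MeasureTheory

namespace Literature.MathematicalPhysics.QuantumFieldTheory.Balaban1983to89.Node00

open T4Continuum (T4Family)
open FlowStep (HBeta prefixOf)
open FlowStepRuns (genSeq)
open T4FlagMemory (extd)
open B12Eq019ActionBody (printedSeq nextAction wilsonTerm)
open B12GaugeOrbits021 (OrbitRel)

variable (F : T4Family) (N : ℕ) [NeZero N]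

/-! ## §1. [I] (0.21), (1.1)–(1.2) p. 256 ∕ p. 260: the background configuration `U_k(V)` and `A^η(U_k(V))` -/

/-- **The regularity class of the level-`k` variational problem** — the first clause of [I] (1.2) p. 260: `|U(∂p) − 1| < ε₀ η²`,
`η = L^{−k}` (`Params.eta`), on the finest torus of the `K`-th approximation; print's `ε₀` is the numeric parameter `ε`
(admissible iff `B₃ε₁ ≤ ε₀ ≤ a₀`, [B11] Thm 1 — numeric, not typed here).  Divergence D-defB-1: the current clause of (1.2) is not
part of the class. [cite: Balaban1987RG1, (1.2) p.260] -/
def bgReg (K k : ℕ) (ε : ℝ) : Set (GaugeField (F.P K) 0 (SU N)) :=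
  {U | PlaqSmall (ε * (F.P K).eta k ^ 2) U}

/-- Membership in the regularity class (definitional). [cite: Balaban1987RG1, (1.2) p.260 (bookkeeping)] -/
theorem mem_bgReg_iff (K k : ℕ) (ε : ℝ) (U : GaugeField (F.P K) 0 (SU N)) :
    U ∈ bgReg F N K k ε ↔ PlaqSmall (ε * (F.P K).eta k ^ 2) U := Iff.rfl

/-- **«there exists … a minimal orbit» — the EXISTENCE clause of [I] (1.1) as a NAMED Prop**: the variational problem (0.21)
`A(U) → min` on `{U : Ū^k = V}` within `bgReg` has a solution (`Setup.IsBackground` along the averaging of record).  Its truth for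
regular `V` is [B11] Thm 1 — a hypothesis wherever used, never asserted. [cite: Balaban1985Variational, Thm 1 p.279] -/
def UkExists (K k : ℕ) (ε : ℝ) (V : GaugeField (F.P K) k (SU N)) : Prop :=
  ∃ U₀ : GaugeField (F.P K) 0 (SU N), IsBackground (avOfRecord F N K) (bgReg F N K k ε) k V U₀

/-- **«exactly one regular, critical orbit» — the UNIQUENESS clause of [I] (1.1) as a NAMED Prop**: any two solutions of (0.21) lie
in one orbit of the residual gauge group of level `k` (`B12GaugeOrbits021.OrbitRel`).  [B11] Thm 1's content, never asserted.
[cite: Balaban1985Variational, Thm 1 p.279] -/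
def UniqueUkOrbit (K k : ℕ) (ε : ℝ) (V : GaugeField (F.P K) k (SU N)) : Prop :=
  ∀ U₀ U₀' : GaugeField (F.P K) 0 (SU N), IsBackground (avOfRecord F N K) (bgReg F N K k ε) k V U₀ →
    IsBackground (avOfRecord F N K) (bgReg F N K k ε) k V U₀' → OrbitRel k U₀ U₀'

/-- **`U_k(V)` OF RECORD** — [I] p. 260: *«We denote by U_k(V) a configuration in the minimal orbit»*: a TOTAL definition choosing
(`Classical.choose`) a solution of (0.21) when one exists (`UkExists`) and the unit configuration otherwise (documented junk
default; chair ruling R434 (c2)).  Consumers use only `isBackground_Uk`. [cite: Balaban1987RG1, (0.21) p.256] -/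
def Uk (K k : ℕ) (ε : ℝ) (V : GaugeField (F.P K) k (SU N)) : GaugeField (F.P K) 0 (SU N) := by
  classical
  exact if h : UkExists F N K k ε V then Classical.choose h else 1

variable {F N}

/-- Unfolding on the solvable set. [cite: Balaban1987RG1, (0.21) p.256 (bookkeeping)] -/
theorem Uk_eq_choose {K k : ℕ} {ε : ℝ} {V : GaugeField (F.P K) k (SU N)} (h : UkExists F N K k ε V) :
    Uk F N K k ε V = Classical.choose h := by
  unfold Uk
  rw [dif_pos h]

/-- Off the solvable set `U_k(V)` is the unit configuration (the junk default). [cite: Balaban1987RG1, (0.21) p.256 (bookkeeping)] -/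
theorem Uk_of_not {K k : ℕ} {ε : ℝ} {V : GaugeField (F.P K) k (SU N)} (h : ¬ UkExists F N K k ε V) :
    Uk F N K k ε V = 1 := by
  unfold Uk
  rw [dif_neg h]

/-- **THE CHARACTERISING PROPERTY** (`wilsonBG_spec` of ruling R434 (c2)): whenever the level-`k` problem at `V` is solvable — in
print, by [B11] Thm 1 — `U_k(V)` IS a minimiser of `A` on `{Ū^k = V}` within the regularity class. [cite: Balaban1985Variational, Thm 1 p.279] -/
theorem isBackground_Uk {K k : ℕ} {ε : ℝ} {V : GaugeField (F.P K) k (SU N)} (h : UkExists F N K k ε V) :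
    IsBackground (avOfRecord F N K) (bgReg F N K k ε) k V (Uk F N K k ε V) := by
  rw [Uk_eq_choose h]
  exact Classical.choose_spec h

/-- `Ū^k(U_k(V)) = V` on the solvable set. [cite: Balaban1987RG1, (0.21) p.256] -/
theorem iter_Uk {K k : ℕ} {ε : ℝ} {V : GaugeField (F.P K) k (SU N)} (h : UkExists F N K k ε V) :
    Averaging.iter (avOfRecord F N K) k (Uk F N K k ε V) = V :=
  (isBackground_Uk h).1

/-- `U_k(V) ∈ U_k(ε₀)` (first clause of (1.2)) on the solvable set. [cite: Balaban1987RG1, (1.2) p.260] -/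
theorem Uk_mem_bgReg {K k : ℕ} {ε : ℝ} {V : GaugeField (F.P K) k (SU N)} (h : UkExists F N K k ε V) :
    Uk F N K k ε V ∈ bgReg F N K k ε :=
  (isBackground_Uk h).2.1

/-- Minimality of `A(U_k(V))` among regular configurations over `V`, on the solvable set. [cite: Balaban1987RG1, (0.21) p.256] -/
theorem wilsonAction4_Uk_le {K k : ℕ} {ε : ℝ} {V : GaugeField (F.P K) k (SU N)} (h : UkExists F N K k ε V)
    {U : GaugeField (F.P K) 0 (SU N)} (hU : U ∈ bgReg F N K k ε) (hUV : Averaging.iter (avOfRecord F N K) k U = V) :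
    wilsonAction4 (Uk F N K k ε V) ≤ wilsonAction4 U :=
  (isBackground_Uk h).2.2 U hU hUV

/-- **The VALUE `A(U_k(V))` is canonical**: every minimiser of the level-`k` problem at `V` has the Wilson action of the chosen one
(mutual minimality) — the gauge ambiguity of `U_k(V)` never reaches `wilsonBGOfRecord`. [cite: Balaban1987RG1, (0.21)–(0.22) p.256] -/
theorem wilsonAction4_eq_of_isBackground {K k : ℕ} {ε : ℝ} {V : GaugeField (F.P K) k (SU N)} {U₀ : GaugeField (F.P K) 0 (SU N)}
    (h : IsBackground (avOfRecord F N K) (bgReg F N K k ε) k V U₀) : wilsonAction4 U₀ = wilsonAction4 (Uk F N K k ε V) :=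
  le_antisymm (h.2.2 _ (Uk_mem_bgReg ⟨U₀, h⟩) (iter_Uk ⟨U₀, h⟩)) (wilsonAction4_Uk_le ⟨U₀, h⟩ h.2.1 h.1)

variable (F N)

/-- **`A^η(U_k(V))` OF RECORD** — the Wilson action (0.2) (`d = 4`: `η^{d−4} = 1`, `Setup.wilsonAction4`) of the background
configuration, per run `p` and step `k`; EXACTLY the type of `Residual₅.wilsonBG` once `ε` is fixed. [cite: Balaban1987RG1, (0.22) p.256] -/
def wilsonBGOfRecord (ε : ℝ) (p : B12.RunParams) (k : ℕ) (V : GaugeField (F.P p.K) k (SU N)) : ℝ :=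
  wilsonAction4 (Uk F N p.K k ε V)

/-- `A^η(U_k(V)) ≥ 0` (each Wilson term `1 − Re tr U(∂p) ≥ 0`, `Setup.wilsonAction4_nonneg`). [cite: Balaban1987RG1, (0.2) p.252] -/
theorem wilsonBGOfRecord_nonneg (ε : ℝ) (p : B12.RunParams) (k : ℕ) (V : GaugeField (F.P p.K) k (SU N)) :
    0 ≤ wilsonBGOfRecord F N ε p k V :=
  wilsonAction4_nonneg _

/-- Off the solvable set `A^η(U_k(V)) = A^η(1)`. [cite: Balaban1987RG1, (0.22) p.256 (bookkeeping)] -/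
theorem wilsonBGOfRecord_of_not (ε : ℝ) (p : B12.RunParams) (k : ℕ) {V : GaugeField (F.P p.K) k (SU N)}
    (h : ¬ UkExists F N p.K k ε V) : wilsonBGOfRecord F N ε p k V = wilsonAction4 (1 : GaugeField (F.P p.K) 0 (SU N)) := by
  unfold wilsonBGOfRecord
  rw [Uk_of_not h]

variable {F N}

/-- **Base of the induction, `k = 0`** (no averaging: `Averaging.iter _ 0 = id`): the level-`0` problem at `V` is solvable iff `V`
itself is regular — [I] (0.17): at the start `U_0(V) = V` and `A_0 = −(1/g_0²) A(V)`. [cite: Balaban1987RG1, (0.17) p.255 (bookkeeping)] -/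
theorem ukExists_zero_iff {K : ℕ} {ε : ℝ} {V : GaugeField (F.P K) 0 (SU N)} :
    UkExists F N K 0 ε V ↔ V ∈ bgReg F N K 0 ε := by
  constructor
  · rintro ⟨U₀, h0, hreg, -⟩
    have : U₀ = V := h0
    exact this ▸ hreg
  · intro hV
    exact ⟨V, rfl, hV, fun U _ hU => by rw [show U = V from hU]⟩

/-- `U_0(V) = V` for regular `V`. [cite: Balaban1987RG1, (0.17) p.255 (bookkeeping)] -/
theorem Uk_zero {K : ℕ} {ε : ℝ} {V : GaugeField (F.P K) 0 (SU N)} (h : UkExists F N K 0 ε V) : Uk F N K 0 ε V = V :=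
  iter_Uk h

/-- `A^η(U_0(V)) = A(V)` for regular `V`. [cite: Balaban1987RG1, (0.17) p.255 (bookkeeping)] -/
theorem wilsonBGOfRecord_zero {ε : ℝ} {p : B12.RunParams} {V : GaugeField (F.P p.K) 0 (SU N)} (hV : V ∈ bgReg F N p.K 0 ε) :
    wilsonBGOfRecord F N ε p 0 V = wilsonAction4 V := by
  unfold wilsonBGOfRecord
  rw [Uk_zero (ukExists_zero_iff.2 hV)]

variable (F N)

/-! ## §2. [I] (0.17)–(0.19), (0.22) pp. 255–256: the gauge fixing, the effective actions `A_k` and the expansion terms `𝐄_k` -/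

/-- **The contour variables of the gauge fixing** — [I] p. 254: *«In order to maintain the Euclidean invariance on the lattice T^{(1)} we
have to use other expressions than the contour variables U(Γ_{y,x}). We use the variables U(y,x) defined in (0.11)»*: the averaged
contour variables (0.11) with Federbush's inner mean (0.10) (`BlockAveragingTwoLevel.contourData FederbushMean.federbushSU`; off
admissible families the single staircase, the tree's total `holTo`). [cite: Balaban1987RG1, (0.11) p.253] -/
def contourOfRecord (K k : ℕ) : ContourData (F.P K) k (SU N) :=
  BlockAveragingTwoLevel.contourData FederbushMean.federbushSU

/-- **The gauge-fixing term of (0.17)∕(0.19)**: `Σ_y Σ_{x ∈ B(y), x ≠ y} [1 − Re tr U(y,x)]` over ALL blocks of the next lattice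
(`Setup.gaugeFixFn` at `Finset.univ`). [cite: Balaban1987RG1, (0.19) p.255] -/
def gfOfRecord (K k : ℕ) : Density (F.P K) k (SU N) :=
  gaugeFixFn (contourOfRecord F N K k) Finset.univ

/-- **THE EFFECTIVE ACTIONS `A_k` AT A FREE COUPLING SEQUENCE** — [I] p. 256: *«the sequence of actions and coupling constants is
defined for k = 0, 1, …, K»*: `A_0 = −(1/g_0²)A` (0.17) and `A_{k+1} = 𝐓_k A_k` (0.19) = `log N_k⁻¹ ∫dU Π_c δ(Ū(c)V⁻¹(c)) χ_k
exp[−(1/g_k²) Σ_yΣ_x [1 − Re tr U(y,x)] + A_k(g_k, U)]`, the tree's `B12Eq019ActionBody.printedSeq` WITH BODY at the renormalisation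
transformation OF RECORD `TrhoOfRecord F N K`, the characteristic functions `χ K g` (stage ₇; they may read the couplings — the radii
`R_k = R(g_k)` of [III] (2.17) do) and the gauge fixing `gfOfRecord`; `A_k` reads `g_0, …, g_{k−1}`. [cite: Balaban1987RG1, (0.19) p.255] -/
def effActionH (χ : (K : ℕ) → (ℕ → ℝ) → (k : ℕ) → Density (F.P K) k (SU N)) (K : ℕ) (g : ℕ → ℝ) : (k : ℕ) → Density (F.P K) k (SU N) :=
  printedSeq (fun k => TrhoOfRecord F N K k) (χ K g) (gfOfRecord F N K) g 1

/-- `A_0 = −(1/g_0²) A` (0.17). [cite: Balaban1987RG1, (0.17) p.255] -/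
theorem effActionH_zero (χ : (K : ℕ) → (ℕ → ℝ) → (k : ℕ) → Density (F.P K) k (SU N)) (K : ℕ) (g : ℕ → ℝ) :
    effActionH F N χ K g 0 = wilsonTerm (g 0) 1 := rfl

/-- `A_{k+1} = 𝐓_k A_k` (0.19) at the transformation of record. [cite: Balaban1987RG1, (0.19) p.255] -/
theorem effActionH_succ (χ : (K : ℕ) → (ℕ → ℝ) → (k : ℕ) → Density (F.P K) k (SU N)) (K : ℕ) (g : ℕ → ℝ) (k : ℕ) :
    effActionH F N χ K g (k + 1) =
      nextAction (TrhoOfRecord F N K k) (χ K g k) (gfOfRecord F N K k) (g k) (effActionH F N χ K g k) := rfl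

/-- `A_{k+1}(1) = 0` — the normalisation «𝐍_k is given by the integral above with V = 1» (0.19), unconditionally
(`B12Eq019ActionBody.nextAction_one`; lemma shape from dag-n09-b's stage-8 bytes). [cite: Balaban1987RG1, (0.19) p.255] -/
theorem effActionH_succ_one (χ : (K : ℕ) → (ℕ → ℝ) → (k : ℕ) → Density (F.P K) k (SU N)) (K : ℕ) (g : ℕ → ℝ) (k : ℕ) :
    effActionH F N χ K g (k + 1) 1 = 0 := by
  rw [effActionH_succ]
  exact B12Eq019ActionBody.nextAction_one _ _ _ _ _

/-- **THE NORMALISATION CONSTANTS `𝐍_k` AT A FREE COUPLING SEQUENCE** — (0.19) p. 255: *«𝐍_k is given by the integral above with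
V = 1»*: `𝐍_k(g) := (T_k(χ_k e^{−GF/g_k² + A_k}))(1)` at the renormalisation transformation OF RECORD, the characteristic functions `χ K g`
and the pinned gauge fixing (`B12Eq019ActionBody.normConst`).  These per-step vacuum normalisations are the ₈-side input of the vacuum
energy `E` of stage ₇ (with the actions normalised by `A_{k+1}(1) = 0`, `effActionH_succ_one`, the small-field constant of `k` steps is
`Σ_{j<k} log 𝐍_j`); the further split [III] (1.15) p. 249 of `log 𝐍_j` into `d(𝔤) log g_j |T^{(j)*}| + log σ₀ |T^{(j)*}| − log z_j (L⁴−1)|T₁^{(j+1)}|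
+ E^{(j+1)}(T^{(j+1)}, g_j, 1)` is DISPLAYED (the Gaussian normalisation `z_j` has no carrier before the fluctuation covariance is an object —
divergence D-defB-2). [cite: Balaban1987RG1, (0.19) p.255] -/
def normConstH (χ : (K : ℕ) → (ℕ → ℝ) → (k : ℕ) → Density (F.P K) k (SU N)) (K : ℕ) (g : ℕ → ℝ) (k : ℕ) : ℝ :=
  B12Eq019ActionBody.normConst (TrhoOfRecord F N K k) (χ K g k) (gfOfRecord F N K k) (g k) (effActionH F N χ K g k)

/-- **`𝐍_k · exp A_{k+1}(V) = (T_k(χ_k e^{−GF/g_k² + A_k}))(V)`** at the record, wherever the transformed density is positive at `V` and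
at `1` ((0.19) exponentiated; `B12Eq019ActionBody.normConst_mul_exp_nextAction`). [cite: Balaban1987RG1, (0.19) p.255] -/
theorem normConstH_mul_exp_effActionH_succ (χ : (K : ℕ) → (ℕ → ℝ) → (k : ℕ) → Density (F.P K) k (SU N)) (K : ℕ) (g : ℕ → ℝ) (k : ℕ)
    {V : GaugeField (F.P K) (k + 1) (SU N)} (hN : 0 < normConstH F N χ K g k)
    (hV : 0 < TrhoOfRecord F N K k
      (B12Eq019ActionBody.integrand (χ K g k) (gfOfRecord F N K k) (g k) (effActionH F N χ K g k)) V) :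
    normConstH F N χ K g k * Real.exp (effActionH F N χ K g (k + 1) V) =
      TrhoOfRecord F N K k (B12Eq019ActionBody.integrand (χ K g k) (gfOfRecord F N K k) (g k) (effActionH F N χ K g k)) V :=
  B12Eq019ActionBody.normConst_mul_exp_nextAction _ _ _ _ _ hN hV

/-- **`𝐍_k` OF RECORD** — the normalisation constant of run `p` at step `k` at the generated coupling sequence; `Real.log` of it, summed over
`j < p.K`, is the body available this week for stage ₇'s vacuum energy `E` (the (1.15) [III] split displayed, see `normConstH`).
[cite: Balaban1987RG1, (0.19)–(0.20) pp.255–256] -/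
def normConstOfRecord (χ : (K : ℕ) → (ℕ → ℝ) → (k : ℕ) → Density (F.P K) k (SU N)) (β : HBeta) (p : B12.RunParams) (k : ℕ) : ℝ :=
  normConstH F N χ p.K (genSeq β p.g0) k

/-- **`A_k(g_k, V)` OF RECORD** — the effective action of run `p` at step `k`, at the coupling sequence generated forward from `g₀` by
(0.20) with the β-functions `β` (`FlowStepRuns.genSeq`); EXACTLY the type of `Residual₅.effAction` once `χ`, `β` are fixed.
[cite: Balaban1987RG1, (0.19)–(0.20) pp.255–256] -/
def effActionOfRecord (χ : (K : ℕ) → (ℕ → ℝ) → (k : ℕ) → Density (F.P K) k (SU N)) (β : HBeta) (p : B12.RunParams) (k : ℕ)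
    (V : GaugeField (F.P p.K) k (SU N)) : ℝ :=
  effActionH F N χ p.K (genSeq β p.g0) k V

/-- **`𝐄_k(U_k(V))` OF RECORD — (0.22) READ AS ITS DEFINITION**, verbatim [I] p. 265 (before (2.1)): *«The meaning of the function 𝐄_k is
obvious, it is equal to (1/g_k²)A + A_k»*: `𝐄_k(U_k(V)) := A_k(g_k, V) + (1/g_k²) A^η(U_k(V))`; EXACTLY the type of `Residual₅.Ek` once `χ`, `ε`,
`β` are fixed.  (The representation (0.23)–(0.24) of this quantity is print's Theorem 1 — the format predicate `ReprAOfRecord` below, never a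
definition.) [cite: Balaban1987RG1, (0.22) p.256 and p.265] -/
def EkOfRecord (χ : (K : ℕ) → (ℕ → ℝ) → (k : ℕ) → Density (F.P K) k (SU N)) (ε : ℝ) (β : HBeta) (p : B12.RunParams) (k : ℕ)
    (V : GaugeField (F.P p.K) k (SU N)) : ℝ :=
  effActionOfRecord F N χ β p k V + (1 / (genSeq β p.g0 k) ^ 2) * wilsonBGOfRecord F N ε p k V

/-- **(0.22) at the record holds by `ring`** — SAID: with `𝐄_k` defined by (0.22) the identity `A_k = −(1/g_k²)A^η(U_k) + 𝐄_k` carries no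
content at the record's own objects (the content sits in `effAction := printedSeq …` and in the bounds on `𝐄_k`). [cite: Balaban1987RG1, (0.22) p.256] -/
theorem effActionOfRecord_eq_repr022 (χ : (K : ℕ) → (ℕ → ℝ) → (k : ℕ) → Density (F.P K) k (SU N)) (ε : ℝ) (β : HBeta) (p : B12.RunParams)
    (k : ℕ) (V : GaugeField (F.P p.K) k (SU N)) :
    effActionOfRecord F N χ β p k V =
      -(1 / (genSeq β p.g0 k) ^ 2) * wilsonBGOfRecord F N ε p k V + EkOfRecord F N χ ε β p k V := by
  unfold EkOfRecord
  ring

/-! ## §3. [I] (1.6) p. 261: the merged per-step terms `𝓝_{k+1}` and their export to the β-layer -/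

/-- **THE MERGED TERM OF STEP `k+1`** (design (β)): `𝓝_{k+1}(g; W) := A_{k+1}(W) − A_k(Ū^k(U_{k+1}(W)))` for a configuration `W` on
`T^{(k+1)}` and a free coupling sequence `g` (reads `g_0, …, g_k`) — under the representation (1.6) p. 261 this is
`𝐄^{(k+1)}(g_k, U_{k+1}(W)) − 𝐄^{(k+1)}(g_k, 1)` (the `log Z^{(k)}` terms merged in, p. 261), whose second variation (1.20) and second
moment (1.22) give `β_{k+1}`; the identification is a theorem of [I], not asserted. [cite: Balaban1987RG1, (1.6) p.261] -/
def mergedTerm (χ : (K : ℕ) → (ℕ → ℝ) → (k : ℕ) → Density (F.P K) k (SU N)) (ε : ℝ) (K : ℕ) (g : ℕ → ℝ) (k : ℕ)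
    (W : GaugeField (F.P K) (k + 1) (SU N)) : ℝ :=
  effActionH F N χ K g (k + 1) W - effActionH F N χ K g k (Averaging.iter (avOfRecord F N K) k (Uk F N K (k + 1) ε W))

variable {F} in
/-- The total retraction of a matrix onto `SU(N)` (identity on `SU(N)`, the unit elsewhere): reads the values `exp(ρB)` of the chart
`B12PolarizationTensor120.expChart` (which lie in `SU(N)` for `B` in the Lie algebra) as group elements. [folklore] -/
def suOfMat (A : Matrix (Fin N) (Fin N) ℂ) : SU N := by
  classical
  exact if h : A ∈ Matrix.specialUnitaryGroup (Fin N) ℂ then ⟨A, h⟩ else 1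

variable {N} in
omit [NeZero N] in
/-- On `SU(N)` the retraction is the identity (bookkeeping for the chart values `exp(ρB) ∈ SU(N)` of (1.20)). [cite: Balaban1987RG1, (1.20) p.264 (bookkeeping)] -/
theorem suOfMat_of_mem {A : Matrix (Fin N) (Fin N) ℂ} (h : A ∈ Matrix.specialUnitaryGroup (Fin N) ℂ) :
    suOfMat N A = ⟨A, h⟩ := by
  unfold suOfMat
  rw [dif_pos h]

variable {N} in
omit [NeZero N] in
/-- In particular on elements of `SU(N)`. [cite: Balaban1987RG1, (1.20) p.264 (bookkeeping)] -/
theorem suOfMat_coe (u : SU N) : suOfMat N (u : Matrix (Fin N) (Fin N) ℂ) = u :=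
  suOfMat_of_mem u.2

/-- A unit-lattice vector field `W ν x` with values in a carrier `𝔄` (the variable on the bond `⟨x, x + e_ν⟩`, [I] p. 264 before
(1.20)) read as an `SU(N)` gauge field through a reading map `r : 𝔄 → SU(N)` (for matrices: the retraction `suOfMat`).
[cite: Balaban1987RG1, (1.20) p.264] -/
def readField {𝔄 : Type*} (r : 𝔄 → SU N) {K j : ℕ} (W : Fin (F.P K).d → Site (F.P K) j → 𝔄) : GaugeField (F.P K) j (SU N) :=
  fun b => r (W b.dir b.src)

/-- **THE MERGED TERM FAMILY, β-LAYER SHAPE**: `(k, (g_0,…,g_k), K, W) ↦ 𝓝_{k+1}(g; W)` on `𝔄`-valued unit-lattice fields of the torus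
`T^{(k+1)}` of the `K`-th approximation, read through `r : 𝔄 → SU(N)` — by unfolding, a term of `Node00.TermFamily1 F 𝔄` of
`Node00.BetaOfRecord`, so that `betaMerged F (mergedTermFamily F N χ ε r) ρ bV` is the merged β of (1.22) (histories are extended to
sequences by clamping, `T4FlagMemory.extd`; only `g_0, …, g_k` are read).  The carrier `𝔄` (a normed `ℝ`-algebra containing `SU(N)`,
e.g. `Matrix (Fin N) (Fin N) ℂ` under `Matrix.Norms.L2Operator`) and `r` are the assembler's choice. [cite: Balaban1987RG1, (1.20)–(1.22) p.264] -/
def mergedTermFamily (χ : (K : ℕ) → (ℕ → ℝ) → (k : ℕ) → Density (F.P K) k (SU N)) (ε : ℝ) {𝔄 : Type*} (r : 𝔄 → SU N) :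
    (k : ℕ) → (Fin (k + 1) → ℝ) → (K : ℕ) → ((Fin (F.P K).d → Site (F.P K) (k + 1) → 𝔄) → ℝ) :=
  fun k hist K W => mergedTerm F N χ ε K (extd hist) k (readField F N r W)

/-- Unfolding of the family (definitional). [cite: Balaban1987RG1, (1.20) p.264 (bookkeeping)] -/
theorem mergedTermFamily_apply (χ : (K : ℕ) → (ℕ → ℝ) → (k : ℕ) → Density (F.P K) k (SU N)) (ε : ℝ) {𝔄 : Type*}
    (r : 𝔄 → SU N) (k : ℕ) (hist : Fin (k + 1) → ℝ) (K : ℕ) (W : Fin (F.P K).d → Site (F.P K) (k + 1) → 𝔄) :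
    mergedTermFamily F N χ ε r k hist K W = mergedTerm F N χ ε K (extd hist) k (readField F N r W) := rfl

/-- **The matrix reading**: the merged term family on `Matrix (Fin N) (Fin N) ℂ`-valued fields through the retraction `suOfMat` (the values
`exp(ρB)` of the chart `B12PolarizationTensor120.expChart` lie in `SU(N)`, where the retraction is the identity: `suOfMat_coe`).
[cite: Balaban1987RG1, (1.20) p.264] -/
def mergedTermFamilyMat (χ : (K : ℕ) → (ℕ → ℝ) → (k : ℕ) → Density (F.P K) k (SU N)) (ε : ℝ) :
    (k : ℕ) → (Fin (k + 1) → ℝ) → (K : ℕ) → ((Fin (F.P K).d → Site (F.P K) (k + 1) → Matrix (Fin N) (Fin N) ℂ) → ℝ) :=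
  mergedTermFamily F N χ ε (suOfMat N)

/-! ## §4. The format predicates `ReprA` ((0.22)–(0.24) [I]) and `IndA` ((1.1)–(1.22) [I]) OF RECORD -/

/-- **FORMAT PREDICATE «`A_k` is given by (0.22)–(0.24)»** on (history `(g_0,…,g_k)`, domain, action `A`, background action `W`,
expansion term `E`): (0.22) `A(V) = −(1/g_k²) W(V) + E(V)` ∧ (0.23) `E(V) = Σ_{j=1}^{k} [−β_j(g_0,…,g_{j−1}) W(V) + 𝐄^{(j)}(U_k(V))]` with
`𝐄^{(j)}(U_k(V))` READ as the merged term `𝓝_j` at `Ū^j(U_k(V))`, for `V` in the domain.  At the record's own objects (0.22) holds by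
`ring` (SAID, `effActionOfRecord_eq_repr022`); (0.23) is the composition-of-minimisers bookkeeping needing [B11] uniqueness modulo gauge and
the gauge invariance of `A_j` — a theorem (nodes N07 ∕ N09).  Divergence D-defB-2: (0.24) is displayed only. [cite: Balaban1987RG1, (0.22)–(0.24) p.256] -/
def ReprAOfRecord (χ : (K : ℕ) → (ℕ → ℝ) → (k : ℕ) → Density (F.P K) k (SU N)) (ε : ℝ) (β : HBeta) (p : B12.RunParams) (k : ℕ)
    (hist : Fin (k + 1) → ℝ) (dom : Set (GaugeField (F.P p.K) k (SU N))) (A W E : GaugeField (F.P p.K) k (SU N) → ℝ) : Prop :=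
  (∀ V ∈ dom, A V = -(1 / (hist (Fin.last k)) ^ 2) * W V + E V) ∧
  (∀ V ∈ dom, E V = ∑ j ∈ Finset.range k,
      (-(β j (prefixOf (extd hist) j)) * W V +
        mergedTerm F N χ ε p.K (extd hist) j (Averaging.iter (avOfRecord F N p.K) (j + 1) (Uk F N p.K k ε V))))

/-- **FORMAT PREDICATE «`A_k` satisfies the inductive assumptions (1.1)–(1.22)»**, same arguments: (1.1) — for every `V` of the domain
the level-`k` variational problem is solvable (`UkExists`) with a unique minimal residual orbit (`UniqueUkOrbit`) — ∧ the form
(1.3)∕(1.6) of `A_k` (= `ReprAOfRecord`).  The estimates (1.8)–(1.19) and the β-clause p. 264 are displayed, not conjuncts (D-defB-2).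
[cite: Balaban1987RG1, (1.1)–(1.6) pp.260–261] -/
def IndAOfRecord (χ : (K : ℕ) → (ℕ → ℝ) → (k : ℕ) → Density (F.P K) k (SU N)) (ε : ℝ) (β : HBeta) (p : B12.RunParams) (k : ℕ)
    (hist : Fin (k + 1) → ℝ) (dom : Set (GaugeField (F.P p.K) k (SU N))) (A W E : GaugeField (F.P p.K) k (SU N) → ℝ) : Prop :=
  (∀ V ∈ dom, UkExists F N p.K k ε V ∧ UniqueUkOrbit F N p.K k ε V) ∧ ReprAOfRecord F N χ ε β p k hist dom A W E

/-- `IndA ⇒ ReprA` at any arguments (the form clause; [I] p. 261: (1.6) resummed gives (0.22)–(0.23)). [cite: Balaban1987RG1, (1.6) p.261] -/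
theorem reprAOfRecord_of_indAOfRecord {χ : (K : ℕ) → (ℕ → ℝ) → (k : ℕ) → Density (F.P K) k (SU N)} {ε : ℝ} {β : HBeta} {p : B12.RunParams}
    {k : ℕ} {hist : Fin (k + 1) → ℝ} {dom : Set (GaugeField (F.P p.K) k (SU N))} {A W E : GaugeField (F.P p.K) k (SU N) → ℝ}
    (h : IndAOfRecord F N χ ε β p k hist dom A W E) : ReprAOfRecord F N χ ε β p k hist dom A W E :=
  h.2

/-- **The (0.22)-conjunct of `ReprA` HOLDS AT THE RECORD'S OWN OBJECTS for every domain** (history = the generated prefix,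
`A, W, E` = `effActionOfRecord`, `wilsonBGOfRecord`, `EkOfRecord`) — the tautology announced in the module docstring, recorded so that no
crux mistakes it for content. [cite: Balaban1987RG1, (0.22) p.256] -/
theorem reprAOfRecord_fst_atRecord (χ : (K : ℕ) → (ℕ → ℝ) → (k : ℕ) → Density (F.P K) k (SU N)) (ε : ℝ) (β : HBeta) (p : B12.RunParams) (k : ℕ)
    (dom : Set (GaugeField (F.P p.K) k (SU N))) :
    ∀ V ∈ dom, effActionOfRecord F N χ β p k V =
      -(1 / (prefixOf (genSeq β p.g0) k (Fin.last k)) ^ 2) * wilsonBGOfRecord F N ε p k V + EkOfRecord F N χ ε β p k V := by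
  intro V _
  rw [FlowStep.prefixOf_apply, Fin.val_last]
  exact effActionOfRecord_eq_repr022 F N χ ε β p k V

end Literature.MathematicalPhysics.QuantumFieldTheory.Balaban1983to89.Node00

end
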